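import Literature.AnabelianGeometry.SemiGraphs.PSCVertexStabilizerCharacterizationBodies
import Literature.AnabelianGeometry.SemiGraphs.PSCVertexQuotientExistenceProofs
import Literature.AnabelianGeometry.SemiGraphs.PSCVertexQuotientConverseProofs
import Literature.AnabelianGeometry.SemiGraphs.PSCCoveringBranchDataProofs
import HarnessLib

/-!
# [CombGC] Theorem 1.6 (iii), ASSEMBLED: verticially filtration-preserving ⟺ group-theoretically verticial

Mochizuki, *A combinatorial version of the Grothendieck conjecture*, Tohoku Math. J. **59** (2007)
[CombGC], Theorem 1.6 (iii), author's manuscript p. 13 ("Assume that `G`, `H` are sturdy. Then `β` is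
verticially filtration-preserving if and only if it is group-theoretically verticial"), with the amended
proof [IUTchI] Remark 1.2.3 (vii), kurims p. 43 ("necessity follows formally from the characterization of
unramified verticial subgroups given in Remark 1.4.3 [= Rmk. 1.2.3 (iv)] and the characterization of
verticially purely totally ramified … coverings given in Remark 1.4.2").  WRITER'S ASSEMBLY of the cell's
sub-DAG for Thm. 1.6 (`plan/L3/SUBDAG-CombGC-Thm16.md`, row T16-L00 (iii)): abc-iut-w5-d174's closer
`unrVerticiallyFiltrationPreservingIffVerticial_of_bodies` (`PSCVertexStabilizerCharacterizationBodies.lean`,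
rows T16-L16/L16b: sufficiency, the transport along `β`, Rmk. 1.4.2 at every level as a THEOREM, the
level-wise stabilizer recognition) takes as inputs, for every `Π^unr`-covering datum, the three BODIES of
[IUTchI] Rmk. 1.2.3 (iv) — (VQ) the vertex-quotient characterization, (VS) "[nontrivial!] quotients",
(EX) the existence of the quotient `M^unr-vert ↠ M^unr[v] ⊗ F_l` as an elementary abelian quotient of
`M^unr` — and these are DISCHARGED here, at every covering datum `G.restrictBD U hU bd` (abc-iut-L3-t4),
by row T16-L13 (abc-iut-w4-d052: `vertexQuotientCharacterization_of_inputs`, both halves;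
`vertexSetCharacterization_of_inputs`) and by abc-iut-w5-d174's
`exists_isElemAbUnrQuotient_inf_eq_vertexQuotientKer`, from the typed inputs of Rmk. 1.2.3 (iv)
(`ElementaryQuotientVerticiallyRamifiedIff`, `UnrVerticialSplitInjection`) and the rank of `M^unr[v]`
(`UnrVertAbOfRank`) AT THE COVERING DATA:

* `unrVerticiallyFiltrationPreservingIffVerticial_of_inputs` — for sturdy `G`, `H` on profinite groups
  with `Σ = {l}`: Thm. 1.6 (iii) for EVERY `β : Π^unr_G ⥲ Π^unr_H`, from `AbelianizedGrphRank`,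
  `VertCountLeNodeCountSucc` (G, H) and the three Rmk.-1.2.3-(iv) inputs at every `Π^unr`-level;
* `unrVerticialIff_holds_of_inputs` — the typed statement `UnrVerticiallyFiltrationPreservingIffVerticial`
  for all data of `Ω`-type on profinite groups with `Σ_G = Σ_H = {l}`, every input an origin statement BY
  NAME: `RankStatementsHold` (Rmk. 1.1.3), `VertCountLeNodeCountSuccHolds` (connectedness),
  `UnrVerticialCharacterizationHolds` ([IUTchI] Rmk. 1.2.3 (iv)), `UnrVertAbOfRankHolds` (Rmk. 1.1.5),
  `RestrictBDOfPSCTypeHolds` (coverings are of PSC-type).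

Proof-only (0 defs); nothing here takes a side on [IUTchIII] Cor. 3.12.
[cite: MochizukiCombGC2007, Thm 1.6(iii) p.13] [cite: Mochizuki2012, IUTchI Rmk 1.2.3(vii) p.43]
-/

noncomputable section

namespace Literature.AnabelianGeometry.SemiGraphs

namespace PSCDatum

universe u

variable {P : Type u} [Group P] [TopologicalSpace P] [IsTopologicalGroup P] [CompactSpace P]
  [TotallyDisconnectedSpace P]
variable {P' : Type u} [Group P'] [TopologicalSpace P'] [IsTopologicalGroup P'] [CompactSpace P']
  [TotallyDisconnectedSpace P']

/-! ### The three bodies of [IUTchI] Rmk. 1.2.3 (iv) at a covering datum, from row T16-L13 -/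

section Bodies

variable (G : PSCDatum P) (bd : G.BranchData)

/-- (VQ) at every `Π^unr`-level: the vertex-quotient characterization of [IUTchI] Rmk. 1.2.3 (iv) for
the covering datum `G_U` (both halves, row T16-L13), read without its "sturdy"/"`Σ = {l}`" guards.
[cite: Mochizuki2012, IUTchI Rmk 1.2.3(iv) p.42] -/
theorem bodyVQ_restrict {l : ℕ} (hSG : G.Sigma = {l}) (hGs : G.IsSturdy)
    (hiff : ∀ (U : Subgroup P) [U.FiniteIndex] (hU : IsOpen (U : Set P)), G.unrKer ≤ U →
      (G.restrictBD U hU bd).ElementaryQuotientVerticiallyRamifiedIff)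
    (hsplit : ∀ (U : Subgroup P) [U.FiniteIndex] (hU : IsOpen (U : Set P)), G.unrKer ≤ U →
      (G.restrictBD U hU bd).UnrVerticialSplitInjection)
    (hrank : ∀ (U : Subgroup P) [U.FiniteIndex] (hU : IsOpen (U : Set P)), G.unrKer ≤ U →
      (G.restrictBD U hU bd).UnrVertAbOfRank)
    (U : Subgroup P) [U.FiniteIndex] (hU : IsOpen (U : Set P)) (hK : G.unrKer ≤ U)
    (H₁ : Subgroup U) (hH₁ : (G.restrict U hU).IsElemAbUnrQuotient l H₁) :
    (∃ w : (G.restrictGraph U).V, (G.restrict U hU).unrVertAb ⊔ H₁ = ⊤ ∧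
        (G.restrict U hU).unrVertAb ⊓ H₁ = (G.restrict U hU).vertexQuotientKer l w) ↔
      ((G.restrict U hU).IsVerticiallyPurelyTotallyRamified ⊤ H₁ ∧ ∀ H₂ : Subgroup U,
        (G.restrict U hU).IsElemAbUnrQuotient l H₂ →
        (G.restrict U hU).IsVerticiallyPurelyTotallyRamified ⊤ H₂ → H₂ ≤ H₁ → H₂ = H₁) := by
  haveI : CompactSpace U :=
    isCompact_iff_compactSpace.mp (Subgroup.isClosed_of_isOpen U hU).isCompact
  exact (G.restrictBD U hU bd).vertexQuotientCharacterization_of_inputs (hiff U hU hK) (hsplit U hU hK)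
    (hrank U hU hK) (hGs.restrictBD G U hU bd) l hSG H₁ hH₁

/-- (VS) at every `Π^unr`-level: "[nontrivial!] quotients" — `w ↦ Ker_w` injective and no `Ker_w` is
everything, for the covering datum `G_U` (row T16-L13). [cite: Mochizuki2012, IUTchI Rmk 1.2.3(iv) p.42] -/
theorem bodyVS_restrict {l : ℕ} (hSG : G.Sigma = {l}) (hGs : G.IsSturdy)
    (hsplit : ∀ (U : Subgroup P) [U.FiniteIndex] (hU : IsOpen (U : Set P)), G.unrKer ≤ U →
      (G.restrictBD U hU bd).UnrVerticialSplitInjection)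
    (hrank : ∀ (U : Subgroup P) [U.FiniteIndex] (hU : IsOpen (U : Set P)), G.unrKer ≤ U →
      (G.restrictBD U hU bd).UnrVertAbOfRank)
    (U : Subgroup P) [U.FiniteIndex] (hU : IsOpen (U : Set P)) (hK : G.unrKer ≤ U) :
    Function.Injective ((G.restrict U hU).vertexQuotientKer l) ∧
      ∀ w : (G.restrictGraph U).V,
        (G.restrict U hU).vertexQuotientKer l w ≠ (G.restrict U hU).unrVertAb := by
  haveI : CompactSpace U :=
    isCompact_iff_compactSpace.mp (Subgroup.isClosed_of_isOpen U hU).isCompact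
  exact (G.restrictBD U hU bd).vertexSetCharacterization_of_inputs (hsplit U hU hK) (hrank U hU hK)
    (hGs.restrictBD G U hU bd) l hSG

/-- (EX) at every `Π^unr`-level: the quotient `M^unr-vert ↠ M^unr[w] ⊗ F_l` IS the restriction of an
elementary abelian quotient of `M^unr` (abc-iut-w5-d174's existence theorem, at the covering datum).
[cite: Mochizuki2012, IUTchI Rmk 1.2.3(iv) p.42] -/
theorem bodyEX_restrict {l : ℕ} (hSG : G.Sigma = {l}) (hGs : G.IsSturdy)
    (hsplit : ∀ (U : Subgroup P) [U.FiniteIndex] (hU : IsOpen (U : Set P)), G.unrKer ≤ U →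
      (G.restrictBD U hU bd).UnrVerticialSplitInjection)
    (hrank : ∀ (U : Subgroup P) [U.FiniteIndex] (hU : IsOpen (U : Set P)), G.unrKer ≤ U →
      (G.restrictBD U hU bd).UnrVertAbOfRank)
    (U : Subgroup P) [U.FiniteIndex] (hU : IsOpen (U : Set P)) (hK : G.unrKer ≤ U)
    (w : (G.restrictGraph U).V) :
    ∃ H₁ : Subgroup U, (G.restrict U hU).IsElemAbUnrQuotient l H₁ ∧
      (G.restrict U hU).unrVertAb ⊔ H₁ = ⊤ ∧
      (G.restrict U hU).unrVertAb ⊓ H₁ = (G.restrict U hU).vertexQuotientKer l w := by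
  haveI : CompactSpace U :=
    isCompact_iff_compactSpace.mp (Subgroup.isClosed_of_isOpen U hU).isCompact
  have hlS : l ∈ (G.restrictBD U hU bd).Sigma := by
    change l ∈ G.Sigma
    rw [hSG]; exact Set.mem_singleton l
  exact (G.restrictBD U hU bd).exists_isElemAbUnrQuotient_inf_eq_vertexQuotientKer (hsplit U hU hK)
    (hrank U hU hK) (hGs.restrictBD G U hU bd) (G.sigma_prime l (by rw [hSG]; exact Set.mem_singleton l))
    hlS w

end Bodies

/-! ### Theorem 1.6 (iii), from its inputs -/

/-- **[CombGC] Theorem 1.6 (iii) from its inputs** (with [IUTchI] Rmk. 1.2.3 (vii)): for sturdy `G`,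
`H` of pro-`Σ` PSC-type on profinite groups, `Σ = {l}`, and ANY `β : Π^unr_G ⥲ Π^unr_H`: `β` is
verticially filtration-preserving iff it is group-theoretically verticial — granted, BY NAME, Rmk. 1.1.3
(`AbelianizedGrphRank`) and connectedness (`VertCountLeNodeCountSucc`) for `G`, `H`, and at every
`Π^unr`-covering datum `G.restrictBD U hU bd` / `H.restrictBD U₁ hU₁ bd'` the inputs of [IUTchI]
Rmk. 1.2.3 (iv) (`ElementaryQuotientVerticiallyRamifiedIff`, `UnrVerticialSplitInjection`) and Rmk. 1.1.5
(`UnrVertAbOfRank`).  Composition: abc-iut-w5-d174's bodies closer ∘ row T16-L13.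
[cite: MochizukiCombGC2007, Thm 1.6(iii) p.13] -/
theorem unrVerticiallyFiltrationPreservingIffVerticial_of_inputs (G : PSCDatum P) (H : PSCDatum P')
    (β : (P ⧸ G.unrKer) ≃ₜ* (P' ⧸ H.unrKer)) (bd : G.BranchData) (bd' : H.BranchData)
    {l : ℕ} (hSG : G.Sigma = {l}) (hSH : H.Sigma = {l})
    (hrkG : G.AbelianizedGrphRank) (hrkH : H.AbelianizedGrphRank)
    (hiG : G.VertCountLeNodeCountSucc) (hiH : H.VertCountLeNodeCountSucc)
    (hiffG : ∀ (U : Subgroup P) [U.FiniteIndex] (hU : IsOpen (U : Set P)), G.unrKer ≤ U →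
      (G.restrictBD U hU bd).ElementaryQuotientVerticiallyRamifiedIff)
    (hsplitG : ∀ (U : Subgroup P) [U.FiniteIndex] (hU : IsOpen (U : Set P)), G.unrKer ≤ U →
      (G.restrictBD U hU bd).UnrVerticialSplitInjection)
    (hrankG : ∀ (U : Subgroup P) [U.FiniteIndex] (hU : IsOpen (U : Set P)), G.unrKer ≤ U →
      (G.restrictBD U hU bd).UnrVertAbOfRank)
    (hiffH : ∀ (U₁ : Subgroup P') [U₁.FiniteIndex] (hU₁ : IsOpen (U₁ : Set P')), H.unrKer ≤ U₁ →
      (H.restrictBD U₁ hU₁ bd').ElementaryQuotientVerticiallyRamifiedIff)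
    (hsplitH : ∀ (U₁ : Subgroup P') [U₁.FiniteIndex] (hU₁ : IsOpen (U₁ : Set P')), H.unrKer ≤ U₁ →
      (H.restrictBD U₁ hU₁ bd').UnrVerticialSplitInjection)
    (hrankH : ∀ (U₁ : Subgroup P') [U₁.FiniteIndex] (hU₁ : IsOpen (U₁ : Set P')), H.unrKer ≤ U₁ →
      (H.restrictBD U₁ hU₁ bd').UnrVertAbOfRank) :
    G.UnrVerticiallyFiltrationPreservingIffVerticial H β := by
  intro hGs hHs
  exact G.unrVerticiallyFiltrationPreservingIffVerticial_of_bodies H β hSG hSH hrkG hrkH hiG hiH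
    (fun U _ hU hK H₁ hH₁ => G.bodyVQ_restrict bd hSG hGs hiffG hsplitG hrankG U hU hK H₁ hH₁)
    (fun U _ hU hK => G.bodyVS_restrict bd hSG hGs hsplitG hrankG U hU hK)
    (fun U _ hU hK w => G.bodyEX_restrict bd hSG hGs hsplitG hrankG U hU hK w)
    (fun U₁ _ hU₁ hK H₁ hH₁ => H.bodyVQ_restrict bd' hSH hHs hiffH hsplitH hrankH U₁ hU₁ hK H₁ hH₁)
    (fun U₁ _ hU₁ hK => H.bodyVS_restrict bd' hSH hHs hsplitH hrankH U₁ hU₁ hK)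
    (fun U₁ _ hU₁ hK w => H.bodyEX_restrict bd' hSH hHs hsplitH hrankH U₁ hU₁ hK w) hGs hHs

/-! ### Over an origin predicate with profinite data -/

section Origin

variable (Ω : PSCOrigin.{u})

/-- **[CombGC] Theorem 1.6 (iii) as typed (`UnrVerticiallyFiltrationPreservingIffVerticial`), for all
data of `Ω`-type on profinite groups with `Σ_G = Σ_H = {l}` and every `β`** — every input an origin
statement BY NAME: Rmk. 1.1.3 (`RankStatementsHold Ω`), connectedness of the coverings
(`VertCountLeNodeCountSuccHolds Ω`), [IUTchI] Rmk. 1.2.3 (iv) (`UnrVerticialCharacterizationHolds Ω`),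
Rmk. 1.1.5 (`UnrVertAbOfRankHolds Ω`), and "coverings of PSC-type data are of PSC-type"
(`RestrictBDOfPSCTypeHolds Ω`); profiniteness displayed as `hprof`.
[cite: MochizukiCombGC2007, Thm 1.6(iii) p.13] -/
theorem unrVerticialIff_holds_of_inputs
    (hprof : ∀ ⦃Q : Type u⦄ [Group Q] [TopologicalSpace Q] [IsTopologicalGroup Q] (K : PSCDatum Q),
      Ω.IsOfPSCType K → CompactSpace Q ∧ TotallyDisconnectedSpace Q)
    (hrank : RankStatementsHold Ω) (hconn : VertCountLeNodeCountSuccHolds Ω)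
    (hunr : UnrVerticialCharacterizationHolds Ω) (hrankv : UnrVertAbOfRankHolds Ω)
    (hres : RestrictBDOfPSCTypeHolds Ω)
    ⦃Q : Type u⦄ [Group Q] [TopologicalSpace Q] [IsTopologicalGroup Q]
    ⦃Q' : Type u⦄ [Group Q'] [TopologicalSpace Q'] [IsTopologicalGroup Q']
    {G : PSCDatum Q} {H : PSCDatum Q'} (hGΩ : Ω.IsOfPSCType G) (hHΩ : Ω.IsOfPSCType H)
    {l : ℕ} (hSG : G.Sigma = {l}) (hSH : H.Sigma = {l}) (β : (Q ⧸ G.unrKer) ≃ₜ* (Q' ⧸ H.unrKer)) :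
    G.UnrVerticiallyFiltrationPreservingIffVerticial H β := by
  obtain ⟨hcQ, htQ⟩ := hprof G hGΩ
  obtain ⟨hcQ', htQ'⟩ := hprof H hHΩ
  haveI := hcQ; haveI := htQ; haveI := hcQ'; haveI := htQ'
  obtain ⟨bd, hbd⟩ := hres G hGΩ
  obtain ⟨bd', hbd'⟩ := hres H hHΩ
  exact G.unrVerticiallyFiltrationPreservingIffVerticial_of_inputs H β bd bd' hSG hSH (hrank G hGΩ).1
    (hrank H hHΩ).1 (hconn G hGΩ) (hconn H hHΩ)
    (fun U _ hU _ => (hunr _ (hbd U hU)).2) (fun U _ hU _ => (hunr _ (hbd U hU)).1)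
    (fun U _ hU _ => hrankv _ (hbd U hU))
    (fun U₁ _ hU₁ _ => (hunr _ (hbd' U₁ hU₁)).2) (fun U₁ _ hU₁ _ => (hunr _ (hbd' U₁ hU₁)).1)
    (fun U₁ _ hU₁ _ => hrankv _ (hbd' U₁ hU₁))

end Origin

end PSCDatum

end Literature.AnabelianGeometry.SemiGraphs

end
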